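/-
Origin: expansion seat `planner-pub-hodgecm-toy2-g6-0`, handover #2 2026-08-18T10:52:34Z (`HOME/pub-hodgecm-toy2-g6/lean/Toy2g6/ToyConjTwist.lean`, md5 e9c6f900, 202 lines);
landed by the gen-7 packager in gate run 28 as `HodgeCM/Model/Toy/ToyConjTwist.lean` (import ^import Toy2g6\.ConjTwist\b→import HodgeCM.Model.ConjTwist ×1).
-/
/-
Copyright: pub-hodgecm formalisation cell (harness21, 2026). New file (not vendored).
Origin: HOME/pub-hodgecm-toy2-g6/lean/Toy2g6/ToyConjTwist.lean — session planner-pub-hodgecm-toy2-g6-0 (unit pub-hodgecm-toy2-g6,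
CONSISTENCY seat 2, part (6a)(ii), generation 6).  WIP module `Toy2g6.ToyConjTwist`; intended final place
`HodgeCM/Model/Toy/ToyConjTwist.lean` (module `HodgeCM.Model.Toy.ToyConjTwist`).  ONE import to rewrite on landing:
`Toy2g6.ConjTwist` ↦ `HodgeCM.Model.ConjTwist`.
-/
import Summits.HodgeConjecture.HodgeCM.Model.ConjTwist_2
import Summits.HodgeConjecture.HodgeCM.Model.Toy.ToyCupScale
import Summits.HodgeConjecture.HodgeCM.Model.Toy.ToyF2
import Summits.HodgeConjecture.HodgeCM.Model.Toy.CMInflation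

/-!
# N2 `Fact_cup_hodge` is independent of the other named inputs: the conjugate-twisted exterior model

`twistModel := toyModel.conjTwist twistDeg` is the exterior model (`HodgeCM.Model.Toy`) with the Hodge structure of
`H^k(X)` replaced by its complex conjugate in every degree `k ≥ 3` divisible by `3` (`twistDeg k := 3 ∣ k`; the set of
twisted degrees is stable under `k ↦ 2k` in both directions, as M5 requires, and avoids `0, 1, 2`).  By the generic transfer
(`Toy2g6.ConjTwist` → `HodgeCM.Model.ConjTwist`) it satisfies all 28 `ModelAxioms`, N1, N3, N4, F2, F4, F5, F7, F7d, F7d-B,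
`Fact_unitH0`, N5, `Fact_cmInflation`, `Fact_H0_rank`, `Fact_dimProd`, M29 `Fact_weightSpan`, `W_RK4`, `PohlmannSpan`,
`Qw8Sufficiency`, `Qw8MilnePos`, `CMProdH0Nontrivial`, `CMProdConnected` and the conclusion `HC_CM` — and **N2 fails** in it
(`H³(A_{(ℚ(ζ₇),Φ)}, ℚ) = ⋀³ ℚ⁶ ≠ 0` is a twisted degree), as does the derived fact M30 `Fact_weightHodge`.

Headline `HodgeCM.Toy.fact_cup_hodge_independent`: N2 is independent of `TwistContext` (the 23 statements above;
`toyModel`: N2 true, `twistModel`: N2 false).  FACTS §1c P5 row N2 ('none filed').  Corollary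
`HodgeCM.Toy.not_fact_weightHodge_of_twistContext`: M30 does not follow from `TwistContext` either, i.e. the hypothesis N2 of
`Universe.weightHodge_of_facts` cannot be dropped.  Nothing is cited; Lean + Mathlib axioms only.
-/

noncomputable section

open scoped TensorProduct

namespace HodgeCM

open Literature.AlgebraicGeometry.Motives (CMType HodgeStructure)

namespace Universe.ConjTwist

variable {U : Universe} {D : ℕ → Bool}

set_option smartUnfolding false in
/-- M38 `Fact_cmInflation` (CM data in degree `1` only) transfers definitionally. -/
theorem fact_cmInflation_iff : (U.conjTwist D).Fact_cmInflation ↔ U.Fact_cmInflation := Iff.rfl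

end Universe.ConjTwist

namespace Toy

open Universe

/-! ### The twisted degrees: multiples of `3` -/

/-- The degrees to conjugate: the multiples of `3` (masked by `degTwist` to the multiples `≥ 3`). -/
def twistDeg (k : ℕ) : Bool := decide (3 ∣ k)

/-- (Ported verbatim from the HodgeCMPerL package; no docstring in the source.) -/
theorem degTwist_twistDeg_three : degTwist twistDeg 3 = true := by decide

/-- `2k` is twisted iff `k` is. -/
theorem degTwist_twistDeg_double (k : ℕ) : degTwist twistDeg (k + k) = degTwist twistDeg k := by
  match k with
  | 0 => rfl
  | 1 => rfl
  | 2 => rfl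
  | k + 3 =>
    rw [degTwist_of_three_le _ (by omega), degTwist_of_three_le _ (by omega)]
    simp only [twistDeg, decide_eq_decide]
    omega

/-! ### `H³` of the CM threefold `A_{(ℚ(ζ₇),Φ)}` -/

/-- `H³(A_{(ℚ(ζ₇),Φ)}, ℚ) = ⋀³ ℚ⁶ ≠ 0` in the exterior model (`cyclo7`, `cyclo7_finrank` of `HodgeCM.Model.Inhabited`). -/
theorem toyModel_exists_nontrivial_H3 :
    ∃ (F : CMField) (n : ℕ) (Θ : Fin (n + 1) → CMType F), Nontrivial (toyModel.Coh (toyModel.cmProd F Θ) 3) := by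
  let Θ : Fin (0 + 1) → CMType cyclo7 := fun _ => stdCMType cyclo7
  have hrk : Module.finrank ℚ (toyModel.cmProd cyclo7 Θ).L = 6 := by
    change Module.finrank ℚ (cmObj cyclo7 (Θ 0)).L = 6
    rw [finrank_L_cmObj, cyclo7_finrank]
  have hfin : Module.finrank ℚ ↥(⋀[ℚ]^3 (toyModel.cmProd cyclo7 Θ).L) = 19 + 1 := by
    haveI : Module.Free ℚ (toyModel.cmProd cyclo7 Θ).L := Module.Free.of_divisionRing ℚ _
    rw [exteriorPower.finrank_eq, hrk]
    rfl
  have hN : Nontrivial ↥(⋀[ℚ]^3 (toyModel.cmProd cyclo7 Θ).L) := Module.nontrivial_of_finrank_eq_succ hfin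
  exact ⟨cyclo7, 0, Θ, hN⟩

/-! ### The twisted exterior model -/

/-- **`twistModel`**: the exterior model with `H^{3m}(X)`, `m ≥ 1`, carrying the conjugate Hodge structure. -/
def twistModel : Universe := toyModel.conjTwist twistDeg

/-- (Ported verbatim from the HodgeCMPerL package; no docstring in the source.) -/
theorem twistModel_def : twistModel = toyModel.conjTwist twistDeg := rfl

/-- (Ported verbatim from the HodgeCMPerL package; no docstring in the source.) -/
theorem twistModel_modelAxioms : twistModel.ModelAxioms :=
  ConjTwist.modelAxioms toyModel_modelAxioms degTwist_twistDeg_double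
/-- (Ported verbatim from the HodgeCMPerL package; no docstring in the source.) -/
theorem twistModel_fact_cupExterior : twistModel.Fact_cupExterior :=
  ConjTwist.fact_cupExterior_iff.mpr toyModel_fact_cupExterior
/-- (Ported verbatim from the HodgeCMPerL package; no docstring in the source.) -/
theorem twistModel_fact_pull_H0 : twistModel.Fact_pull_H0 := ConjTwist.fact_pull_H0_iff.mpr toyModel_fact_pull_H0
/-- (Ported verbatim from the HodgeCMPerL package; no docstring in the source.) -/
theorem twistModel_fact_hodge_F0 : twistModel.Fact_hodge_F0 := ConjTwist.fact_hodge_F0_iff.mpr toyModel_fact_hodge_F0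
/-- (Ported verbatim from the HodgeCMPerL package; no docstring in the source.) -/
theorem twistModel_fact_factorActDescends : twistModel.Fact_factorActDescends :=
  ConjTwist.fact_factorActDescends_iff.mpr (fact_factorActDescends exteriorHodgeData)
/-- (Ported verbatim from the HodgeCMPerL package; no docstring in the source.) -/
theorem twistModel_fact_cupAlg : twistModel.Fact_cupAlg := ConjTwist.fact_cupAlg_iff.mpr fact_cupAlg
/-- (Ported verbatim from the HodgeCMPerL package; no docstring in the source.) -/
theorem twistModel_fact_cupAssoc : twistModel.Fact_cupAssoc :=
  ConjTwist.fact_cupAssoc_iff.mpr (fact_cupAssoc exteriorHodgeData)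
/-- (Ported verbatim from the HodgeCMPerL package; no docstring in the source.) -/
theorem twistModel_fact_gysin : twistModel.Fact_gysin := ConjTwist.fact_gysin_iff.mpr toyModel_fact_gysin
/-- (Ported verbatim from the HodgeCMPerL package; no docstring in the source.) -/
theorem twistModel_fact_gysinDescent : twistModel.Fact_gysinDescent :=
  ConjTwist.fact_gysinDescent_iff.mpr toyModel_fact_gysinDescent
/-- (Ported verbatim from the HodgeCMPerL package; no docstring in the source.) -/
theorem twistModel_fact_gysinDescentB : twistModel.Fact_gysinDescentB :=
  ConjTwist.fact_gysinDescentB_iff.mpr toyModel_fact_gysinDescentB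
/-- (Ported verbatim from the HodgeCMPerL package; no docstring in the source.) -/
theorem twistModel_fact_unitH0 : twistModel.Fact_unitH0 := ConjTwist.fact_unitH0_iff.mpr toyModel_fact_unitH0
/-- (Ported verbatim from the HodgeCMPerL package; no docstring in the source.) -/
theorem twistModel_fact_fundClass : twistModel.Fact_fundClass := ConjTwist.fact_fundClass_iff.mpr toyModel_fact_fundClass
/-- (Ported verbatim from the HodgeCMPerL package; no docstring in the source.) -/
theorem twistModel_fact_cmInflation : twistModel.Fact_cmInflation :=
  ConjTwist.fact_cmInflation_iff.mpr (fact_cmInflation exteriorHodgeData)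
/-- (Ported verbatim from the HodgeCMPerL package; no docstring in the source.) -/
theorem twistModel_fact_H0_rank : twistModel.Fact_H0_rank := ConjTwist.fact_H0_rank_iff.mpr toyModel_fact_H0_rank
/-- (Ported verbatim from the HodgeCMPerL package; no docstring in the source.) -/
theorem twistModel_fact_dimProd : twistModel.Fact_dimProd := ConjTwist.fact_dimProd_iff.mpr toyModel_fact_dimProd
/-- (Ported verbatim from the HodgeCMPerL package; no docstring in the source.) -/
theorem twistModel_fact_weightSpan : twistModel.Fact_weightSpan :=
  ConjTwist.fact_weightSpan_iff.mpr (toyModel_weightSpan toyModel_modelAxioms)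
/-- (Ported verbatim from the HodgeCMPerL package; no docstring in the source.) -/
theorem twistModel_w_rk4 : twistModel.W_RK4 := ConjTwist.w_RK4_iff.mpr toyModel_w_rk4
/-- (Ported verbatim from the HodgeCMPerL package; no docstring in the source.) -/
theorem twistModel_pohlmannSpan : twistModel.PohlmannSpan := ConjTwist.pohlmannSpan_iff.mpr toyModel_pohlmannSpan'
/-- (Ported verbatim from the HodgeCMPerL package; no docstring in the source.) -/
theorem twistModel_qw8Sufficiency : twistModel.Qw8Sufficiency := ConjTwist.qw8Sufficiency_iff.mpr toyModel_qw8Sufficiency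
/-- (Ported verbatim from the HodgeCMPerL package; no docstring in the source.) -/
theorem twistModel_qw8MilnePos : twistModel.Qw8MilnePos := ConjTwist.qw8MilnePos toyModel_qw8MilnePos
/-- (Ported verbatim from the HodgeCMPerL package; no docstring in the source.) -/
theorem twistModel_cmProdH0Nontrivial : twistModel.CMProdH0Nontrivial :=
  ConjTwist.cmProdH0Nontrivial_iff.mpr (cmProdH0Nontrivial exteriorHodgeData)
/-- (Ported verbatim from the HodgeCMPerL package; no docstring in the source.) -/
theorem twistModel_cmProdConnected : twistModel.CMProdConnected :=
  ConjTwist.cmProdConnected_iff.mpr toyModel_cmProdConnected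
/-- (Ported verbatim from the HodgeCMPerL package; no docstring in the source.) -/
theorem twistModel_hc_cm : twistModel.HC_CM := ConjTwist.hc_cm_iff.mpr toyModel_hc_cm

/-- **N2 FAILS in `twistModel`.** -/
theorem not_twistModel_fact_cup_hodge : ¬ twistModel.Fact_cup_hodge :=
  ConjTwist.not_fact_cup_hodge degTwist_twistDeg_three toyModel_fact_cupExterior toyModel_fact_cup_hodge
    toyModel_fact_hodge_F0 toyModel_exists_nontrivial_H3

/-- **M30 FAILS in `twistModel`** (while M29 holds: `twistModel_fact_weightSpan`). -/
theorem not_twistModel_fact_weightHodge : ¬ twistModel.Fact_weightHodge :=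
  ConjTwist.not_fact_weightHodge degTwist_twistDeg_three (toyModel_weightSpan toyModel_modelAxioms)
    (toyModel_weightHodge toyModel_modelAxioms) toyModel_exists_nontrivial_H3

/-- F6 fails in `twistModel` as it does in `toyModel` (recorded for the profile; F6 is refuted in the tree anyway). -/
theorem not_twistModel_fact_weightDual : ¬ twistModel.Fact_weightDual :=
  fun h => not_fact_weightDual exteriorHodgeData (ConjTwist.fact_weightDual_iff.mp h)

/-! ### Independence of N2 -/

/-- The statements both models satisfy: M1–M28, N1 (M31), N3 (M33), N4 (M34), F2 (M35), F4, F5 (M37), F7, F7d (M41), F7d-B,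
`Fact_unitH0` (M43), N5 `Fact_fundClass`, `Fact_cmInflation` (M38), `Fact_H0_rank` (M42), `Fact_dimProd` (M40),
M29 `Fact_weightSpan`, `W_RK4`, `PohlmannSpan`, `Qw8Sufficiency`, `Qw8MilnePos`, `CMProdH0Nontrivial`, `CMProdConnected` and the
conclusion `HC_CM` — every named input of FACTS §1c the exterior model satisfies, except N2 (and its consequence M30). -/
def TwistContext (U : Universe) : Prop :=
  U.ModelAxioms ∧ U.Fact_cupExterior ∧ U.Fact_pull_H0 ∧ U.Fact_hodge_F0 ∧ U.Fact_factorActDescends ∧ U.Fact_cupAlg ∧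
    U.Fact_cupAssoc ∧ U.Fact_gysin ∧ U.Fact_gysinDescent ∧ U.Fact_gysinDescentB ∧ U.Fact_unitH0 ∧ U.Fact_fundClass ∧
    U.Fact_cmInflation ∧ U.Fact_H0_rank ∧ U.Fact_dimProd ∧ U.Fact_weightSpan ∧ U.W_RK4 ∧ U.PohlmannSpan ∧
    U.Qw8Sufficiency ∧ U.Qw8MilnePos ∧ U.CMProdH0Nontrivial ∧ U.CMProdConnected ∧ U.HC_CM

/-- (Ported verbatim from the HodgeCMPerL package; no docstring in the source.) -/
theorem toyModel_twistContext : TwistContext toyModel :=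
  ⟨toyModel_modelAxioms, toyModel_fact_cupExterior, toyModel_fact_pull_H0, toyModel_fact_hodge_F0,
    fact_factorActDescends exteriorHodgeData, fact_cupAlg, fact_cupAssoc exteriorHodgeData, toyModel_fact_gysin,
    toyModel_fact_gysinDescent, toyModel_fact_gysinDescentB, toyModel_fact_unitH0, toyModel_fact_fundClass,
    fact_cmInflation exteriorHodgeData, toyModel_fact_H0_rank, toyModel_fact_dimProd, toyModel_weightSpan toyModel_modelAxioms,
    toyModel_w_rk4, toyModel_pohlmannSpan', toyModel_qw8Sufficiency, toyModel_qw8MilnePos, cmProdH0Nontrivial exteriorHodgeData,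
    toyModel_cmProdConnected, toyModel_hc_cm⟩

/-- (Ported verbatim from the HodgeCMPerL package; no docstring in the source.) -/
theorem twistModel_twistContext : TwistContext twistModel :=
  ⟨twistModel_modelAxioms, twistModel_fact_cupExterior, twistModel_fact_pull_H0, twistModel_fact_hodge_F0,
    twistModel_fact_factorActDescends, twistModel_fact_cupAlg, twistModel_fact_cupAssoc, twistModel_fact_gysin,
    twistModel_fact_gysinDescent, twistModel_fact_gysinDescentB, twistModel_fact_unitH0, twistModel_fact_fundClass,
    twistModel_fact_cmInflation, twistModel_fact_H0_rank, twistModel_fact_dimProd, twistModel_fact_weightSpan,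
    twistModel_w_rk4, twistModel_pohlmannSpan, twistModel_qw8Sufficiency, twistModel_qw8MilnePos,
    twistModel_cmProdH0Nontrivial, twistModel_cmProdConnected, twistModel_hc_cm⟩

/-- the two profiles side by side -/
theorem twistModel_profile : TwistContext twistModel ∧ ¬ twistModel.Fact_cup_hodge ∧ ¬ twistModel.Fact_weightHodge :=
  ⟨twistModel_twistContext, not_twistModel_fact_cup_hodge, not_twistModel_fact_weightHodge⟩

/-- (Ported verbatim from the HodgeCMPerL package; no docstring in the source.) -/
theorem toyModel_twistProfile : TwistContext toyModel ∧ toyModel.Fact_cup_hodge ∧ toyModel.Fact_weightHodge :=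
  ⟨toyModel_twistContext, toyModel_fact_cup_hodge, toyModel_weightHodge toyModel_modelAxioms⟩

/-- **N2 `Fact_cup_hodge` is INDEPENDENT of `ModelAxioms ∧ N1 ∧ N3 ∧ N4 ∧ F2 ∧ F4 ∧ F5 ∧ F7 ∧ F7d ∧ F7d-B ∧ Fact_unitH0 ∧
N5 ∧ Fact_cmInflation ∧ Fact_H0_rank ∧ Fact_dimProd ∧ M29 ∧ W_RK4 ∧ PohlmannSpan ∧ Qw8Sufficiency ∧ Qw8MilnePos ∧
CMProdH0Nontrivial ∧ CMProdConnected ∧ HC_CM`** (`toyModel`: true; `twistModel`: false). -/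
theorem fact_cup_hodge_independent :
    (∃ U : Universe, TwistContext U ∧ U.Fact_cup_hodge) ∧ (∃ U : Universe, TwistContext U ∧ ¬ U.Fact_cup_hodge) :=
  ⟨⟨toyModel, toyModel_twistContext, toyModel_fact_cup_hodge⟩,
    ⟨twistModel, twistModel_twistContext, not_twistModel_fact_cup_hodge⟩⟩

/-- Equivalently: N2 is not a consequence of the list. -/
theorem not_fact_cup_hodge_of_twistContext : ¬ ∀ U : Universe, TwistContext U → U.Fact_cup_hodge :=
  fun h => not_twistModel_fact_cup_hodge (h twistModel twistModel_twistContext)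

/-- **M30 `Fact_weightHodge` is not a consequence of the list either**: the hypothesis N2 of `Universe.weightHodge_of_facts`
(`ModelAxioms → N1 → N2 → N3 → N4 → M30`) cannot be dropped. -/
theorem not_fact_weightHodge_of_twistContext : ¬ ∀ U : Universe, TwistContext U → U.Fact_weightHodge :=
  fun h => not_twistModel_fact_weightHodge (h twistModel twistModel_twistContext)

/-- (Ported verbatim from the HodgeCMPerL package; no docstring in the source.) -/
theorem fact_weightHodge_independent :
    (∃ U : Universe, TwistContext U ∧ U.Fact_weightHodge) ∧ (∃ U : Universe, TwistContext U ∧ ¬ U.Fact_weightHodge) :=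
  ⟨⟨toyModel, toyModel_twistContext, toyModel_weightHodge toyModel_modelAxioms⟩,
    ⟨twistModel, twistModel_twistContext, not_twistModel_fact_weightHodge⟩⟩

end Toy

end HodgeCM

end
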